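import Summits.CriticalPhenomena.PercolationContinuityZ3.Theorems.Transplant.BccSlabHubRoute
import Summits.CriticalPhenomena.PercolationContinuityZ3.Theorems.Transplant.BccClawXStack
import Literature.Probability.LatticeModels.FKIsingAnnulusCrossingProofs
import HarnessLib

/-!
# The bcc (001)-slabs, exit-form routing certificate VII: COLUMN-LEVEL ROUTING from the hub template and the stacked template —
# `θ_{S_k(bcc)}(p_c) = 0` for every `k ≥ 3` MODULO the routing of the exceptional stacked configurations alone

builds on p205010 (kernel theorem, internal audit signed; external expert review pending) — NOT used in this file.
Lane `prim-bschramm`, seat `prim-bschramm-p2` (gen 46; class C1b, METHOD = input substitution; memo `HOME/bschramm/P2-LATTICES.md` §156); helper file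
(`--supports stmt-CriticalPhenomena-4575 --as helper`).
The assembly of the exit-form certificate: «BccSlabClearedSetX».`ColRouting k` (⇒ `ShapedLinkageX 3` ⇒ `θ(p_c) = 0`) asks, for every column-certified
terminal triple, for a swap pair of routings.  By the kernel table («BccClawXLegs».`exists_claw_of_tgtCols`) and the hub template («BccSlabHubRoute»)
this holds for every NON-EXCEPTIONAL triple; the exceptional ones (`stackedExc`: `E₁, E₂` stacked in a column with two usable neighbour columns, `w'` in
one of them) come with a frame («BccClawXStack».`exists_frame_of_tgtCols`) and are the subject of the internal obligation **`BccSlab.StackedRouting k`**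
(§1; discharged by the explicit 3D template «BccSlabStackedRoute*»).
* §1 `StackedRouting`; `centre_not_mem_tgtCols`; **`colRouting_of_stackedRouting`** (`k ≥ 3`);
* §2 **`theta_criticalProb_eq_zero_of_stackedRouting`**: `θ_{S_k(bcc)}(v, p_c) = 0` for every `k ≥ 3` from `StackedRouting k` alone — p205010-free.
[cite: DuminilCopinSidoraviciusTassion2016, Thm. 1 and §2.3 (proof of Fact 2)] [cite: BenjaminiSchramm1996, Conj. 4 / Question 3]
-/

noncomputable section

namespace Summit.CriticalPhenomena.PercolationContinuityZ3.Theorems.Transplant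

namespace BccSlab

open Literature.Probability.Percolation Literature.Probability.LatticeModels SimpleGraph
open BccClawX
open scoped Classical

variable {k : ℕ}

/-! ## §1 Column-level routing from the two templates -/

/-- **STACKED ROUTING** (internal obligation, the exceptional family of the exit-form certificate): for every block pair and every frame `(A; μ, ν)` in the
rerouting region, all `E₁ ≠ E₂` over `A` and `w'` over `A + μ`, a swap pair of `VRouteData` for the cleared sets.  Discharged by «BccSlabStackedRoute*».
[cite: DuminilCopinSidoraviciusTassion2016, §2.3 (proof of Fact 2: the three disjoint paths in B̄_R(z))] -/
def StackedRouting (k : ℕ) : Prop :=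
  ∀ (z : Site 2) (tR tD sR sD : ℕ) (E₁ E₂ w' : bslab k) (μ ν : Pt), E₁ ≠ E₂ → sh E₁ = sh E₂ →
    Frame (Dcols z tD sD ∩ sqBlkR 3 z tR sR) (sh E₁) μ ν → sh w' = fcol (sh E₁) μ ν 1 0 →
      ∃ r₁ r₂ : VRouteData (slabGraph k) (clearedSet k z tD sD ∩ (sqShadow k).lift (sqBlkR 3 z tR sR)) (clearedSet k z tD sD) E₁ E₂ w',
        r₁.y = r₂.b ∧ r₁.b = r₂.y

/-- **The centre column is not a target column** (its four neighbours are cleared: in the window they lie in the block, and within distance `1` they are not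
corners when the block is clipped in at most one direction). [folklore] -/
theorem centre_not_mem_tgtCols {z : Site 2} {tD sD : ℕ} (hts : 3 ≤ tD ∨ 3 ≤ sD) : z ∉ tgtCols z tD sD := by
  rintro ⟨-, q, hadj, ⟨hwin0, hwin1⟩, hq⟩
  apply hq
  have h1 : q ∈ sqBall z 1 := by
    rw [mem_sqBall]
    exact ⟨by rw [abs_sub_comm]; exact_mod_cast abs_sub_le_one_of_zdGraph_two_adj hadj 0,
      by rw [abs_sub_comm]; exact_mod_cast abs_sub_le_one_of_zdGraph_two_adj hadj 1⟩
  refine mem_Dcols_of_sqBall_one hts h1 ?_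
  rw [mem_sqBlkR]
  exact ⟨sqBall_mono z (by norm_num) h1, hwin0, hwin1⟩

/-- **COLUMN-LEVEL ROUTING FOR `S_k(bcc)`, `k ≥ 3`, FROM STACKED ROUTING**: a column-certified triple is either non-exceptional — then the kernel table gives a
planar claw and the hub template a swap pair — or exceptional — then it has a frame and `StackedRouting` applies.
[cite: DuminilCopinSidoraviciusTassion2016, §2.3 (proof of Fact 2)] -/
theorem colRouting_of_stackedRouting (hk : 3 ≤ k) (hS : StackedRouting k) : ColRouting k := by
  intro z tR tD sR sD hRD hSE hone E₁ E₂ w' hne h1 h1R h1z h2 h2R h2z h3 h31 h32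
  have hts : 3 ≤ tD ∨ 3 ≤ sD := hone.imp (fun h => h.trans hRD) (fun h => h.trans hSE)
  have h3z : sh w' ≠ z := fun h => centre_not_mem_tgtCols hts (h ▸ h3)
  by_cases hexc : stackedExc (min tR 3) (min tD 4) (min sR 3) (min sD 4) (rel z (sh E₁)) (rel z (sh E₂)) (rel z (sh w')) = true
  · -- exceptional: the two terminals share a column
    have h12 : sh E₁ = sh E₂ := by
      have hx := hexc
      simp only [stackedExc, Bool.and_eq_true, beq_iff_eq] at hx
      rw [← pt_rel z (sh E₁), hx.1, pt_rel]
    rw [← h12] at hexc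
    obtain ⟨μ, ν, hF, hs⟩ := exists_frame_of_tgtCols hRD hSE hone h1 h1R h1z h3 h3z h31 hexc
    exact hS z tR tD sR sD E₁ E₂ w' μ ν hne h12 hF hs
  · have hexc' : stackedExc (min tR 3) (min tD 4) (min sR 3) (min sD 4) (rel z (sh E₁)) (rel z (sh E₂)) (rel z (sh w')) = false := by
      simpa using hexc
    obtain ⟨q, l1, l2, l3, hP⟩ := exists_claw_of_tgtCols hRD hSE hone h1 h1R h1z h2 h2R h2z h3 h3z h31 h32 hexc'
    exact swapPair_of_clawProps hk hne hP

/-! ## §2 The slabs at their own critical point, modulo stacked routing -/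

/-- **`θ_{S_k(bcc)}(v, p_c(S_k(bcc))) = 0` FOR EVERY `k ≥ 3` FROM `StackedRouting k` ALONE** — the exit-form certificate `ShapedLinkageX 3` with the cleared set
`lift (block ∖ corners)` («BccSlabClearedSetX»), the planar claw oracle («BccClawXTable*», kernel) and the hub template («BccSlabHubRoute»); p205010-free.
[cite: DuminilCopinSidoraviciusTassion2016, Thm. 1 and §2.3] [cite: BenjaminiSchramm1996, Conj. 4 / Question 3] -/
theorem theta_criticalProb_eq_zero_of_stackedRouting (hk : 3 ≤ k) (hS : StackedRouting k) (v : bslab k) :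
    theta (slabGraph k) v (criticalProbIOf (slabGraph k) v) = 0 :=
  theta_criticalProb_eq_zero_of_colRouting (le_trans (by norm_num) hk) (colRouting_of_stackedRouting hk hS) v

end BccSlab

end Summit.CriticalPhenomena.PercolationContinuityZ3.Theorems.Transplant

end
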